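import Mathlib
import Summits.NavierStokesRegularity.NavierStokesRegularity.Theorems.HeteroclinicTriggerChainTriggerChainFrontStepLatticeFrontBlock
import HarnessLib

/-!
# `HeteroclinicTriggerChain` — crux `TriggerChainFrontStep` (item stmt-NavierStokesRegularity-22785):
  the WAKE TRIGGER DECAYS while the new carrier dominates (exact lattice flow)

Envelope supply for the lattice hop lemmas (`…LatticeDelay`, `…LatticeCapture`, `…LatticeSeed` take the
wake-trigger envelope `ω ≥ |S_{i₁,−1}|` as an input). By `htcLB_front_block_shell` at shell `−1`, the old
trigger `w = S_{i₁,−1}` of an exact flow of `α₀ + βσ` obeys `w′ = 2^{−5/2}e·D_{−1}·w + f₂` with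
`D_{−1} = S_{i₀,−1} − S_{i₀,0}` (leftover carrier minus the NEW carrier) and a junk-suppressed remainder
`|f₂| ≤ φ₂ = 2^{−5/2}(8Mι + 4Uι) + 2^{−5}·4ω₂ι + βB_σ` (`U ≥ |S_{i₁,0}|` the running trigger,
`ω₂ ≥ |S_{i₁,−2}|` the deeper wake). Hence, on any sub-window `[s,T]` where the new carrier exceeds the
leftover by `L` (`D_{−1} ≤ −L < 0`), the post-capture decay lemma
(`heteroclinicTriggerChain_forcedArcOn_trigger_decay`) gives

  `|S_{i₁,−1}(t)| ≤ |S_{i₁,−1}(s)|·e^{−2^{−5/2}eL(t−s)} + φ₂/(2^{−5/2}eL)`   (`htcLW_wake_trigger_decay`).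

(After the front has moved on and the new carrier has itself been depleted below the leftover, the sign of
`D_{−1}` flips and the wake trigger re-grows slowly — that regime is not treated here.)

HONEST FRAMING: a statement about exact flows of Tao-type MODEL lattices (Tao 2016 §4) under envelope
hypotheses; helper for the crux (no stub credit); nothing here is a statement about the Navier–Stokes
equations; no summit, rung or crux is proved.
-/

noncomputable section

set_option linter.dupNamespace false

open Real Set

namespace Summit.NavierStokesRegularity.NavierStokesRegularity.Theorems

open Literature.Analysis.FluidPDE Literature.Analysis.FluidPDE.TaoCascade

/-- **Wake trigger decay.** Setting of the module docstring (exact flow of `α₀ + βσ` on `[0,T]`, normal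
form, parity, `g = e = d i₁ 0 > 0`, `|α₀| ≤ 1`, envelopes at shells `−2, −1, 0`), and a sub-window
`[s,T]` on which `S_{i₀,−1} − S_{i₀,0} ≤ −L` with `L > 0`. Then for `t ∈ [s,T]`:
`|S_{i₁,−1}(t)| ≤ |S_{i₁,−1}(s)|·exp(−2^{−5/2}·e·L·(t−s)) + φ₂/(2^{−5/2}·e·L)` with
`φ₂ = 2^{−5/2}(8Mι + 4Uι) + 2^{−5}(4ω₂ι) + βB_σ` (gains written `(1+1)^{5·(−1)/2}`, `(1+1)^{5·(−2)/2}`).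
[this file] -/
theorem htcLW_wake_trigger_decay (α₀ σ : Fin 4 → Fin 4 → Fin 4 → ℤ × ℤ × ℤ → ℝ) (i₀ i₁ : Fin 4)
    (d : Fin 4 → ℤ → ℝ) (hne : i₀ ≠ i₁)
    (hsym : IsSymmetricCoeff α₀) (hcanc : IsCancellingCoeff α₀)
    (hpure : ∀ X : Fin 4 → ℤ → ℝ → ℝ, (∀ i n t, i ≠ i₀ → X i n t = 0) →
      ∀ i n t, quadTerm 1 α₀ X i n t = 0)
    (hsad : ∀ (Y : Fin 4 → ℤ → ℝ → ℝ) (i : Fin 4) (n : ℤ) (t : ℝ),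
      quadTerm 1 α₀ (fun j m s => (fun j m (_ : ℝ) => if j = i₀ ∧ m = 0 then (1 : ℝ) else 0) j m s +
          Y j m s) i n t -
        quadTerm 1 α₀ (fun j m (_ : ℝ) => if j = i₀ ∧ m = 0 then (1 : ℝ) else 0) i n t -
        quadTerm 1 α₀ Y i n t = d i n * Y i n t)
    (hpar : ∀ (j₁ j₂ j₃ : Fin 4) (μ : ℤ × ℤ × ℤ),
      Xor (Xor (j₁ = i₁) (j₂ = i₁)) (j₃ = i₁) → α₀ j₁ j₂ j₃ μ = 0)
    (hα1 : ∀ a b c μ, |α₀ a b c μ| ≤ 1)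
    (hg : α₀ i₁ i₁ i₀ (0, 0, 1) = d i₁ 0) (he : 0 < d i₁ 0)
    (β : ℝ) (hβ : 0 ≤ β) (S : Fin 4 → ℤ → ℝ → ℝ) {T : ℝ}
    (hS : ∀ i k, ∀ t ∈ Icc 0 T, HasDerivWithinAt (S i k)
      (quadTerm 1 α₀ S i k t + β * quadTerm 1 σ S i k t) (Icc 0 T) t)
    {M U ι ω₂ Bσ : ℝ} (hι0 : 0 ≤ ι)
    (hM : ∀ t ∈ Icc 0 T, |S i₀ (-1) t - S i₀ (-1 + 1) t| ≤ M ∧ |S i₁ (-1) t| ≤ M)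
    (hU : ∀ t ∈ Icc 0 T, |S i₁ (-1 + 1) t| ≤ U) (hω : ∀ t ∈ Icc 0 T, |S i₁ (-1 - 1) t| ≤ ω₂)
    (hι : ∀ t ∈ Icc 0 T, ∀ a, a ≠ i₀ → a ≠ i₁ →
      |S a (-1) t| ≤ ι ∧ |S a (-1 + 1) t| ≤ ι ∧ |S a (-1 - 1) t| ≤ ι)
    (hBσ : ∀ t ∈ Icc 0 T, |quadTerm 1 σ S i₀ (-1) t| ≤ Bσ ∧ |quadTerm 1 σ S i₀ (-1 + 1) t| ≤ Bσ ∧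
      |quadTerm 1 σ S i₁ (-1) t| ≤ Bσ)
    {s L φ₂ : ℝ} (hs : 0 ≤ s) (hL : 0 < L)
    (hφ₂ : φ₂ = (1 + 1 : ℝ) ^ ((5 : ℝ) * ((-1 : ℤ) : ℝ) / 2) * (8 * M * ι + 4 * U * ι) +
      (1 + 1 : ℝ) ^ ((5 : ℝ) * ((((-1 : ℤ)) : ℝ) - 1) / 2) * (4 * ω₂ * ι) + β * Bσ)
    (hdom : ∀ t ∈ Icc s T, S i₀ (-1) t - S i₀ (-1 + 1) t ≤ -L) :
    ∀ t ∈ Icc s T, |S i₁ (-1) t| ≤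
      |S i₁ (-1) s| * Real.exp (-((1 + 1 : ℝ) ^ ((5 : ℝ) * ((-1 : ℤ) : ℝ) / 2) * d i₁ 0 * L * (t - s))) +
        φ₂ / ((1 + 1 : ℝ) ^ ((5 : ℝ) * ((-1 : ℤ) : ℝ) / 2) * d i₁ 0 * L) := by
  obtain ⟨f₁, f₂, -, hu, -, hf₂⟩ := htcLB_front_block_shell α₀ σ i₀ i₁ d hne hsym hcanc hpure hsad
    hpar hα1 hg he β hβ S (-1) hS hι0 hM hU hω hι hBσ
  have hγ : 0 < (1 + 1 : ℝ) ^ ((5 : ℝ) * ((-1 : ℤ) : ℝ) / 2) := Real.rpow_pos_of_pos (by norm_num) _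
  have he' : 0 < (1 + 1 : ℝ) ^ ((5 : ℝ) * ((-1 : ℤ) : ℝ) / 2) * d i₁ 0 := mul_pos hγ he
  -- restrict to [s, T] and regroup the rate
  have hu' : ∀ t ∈ Icc s T, HasDerivWithinAt (S i₁ (-1))
      ((1 + 1 : ℝ) ^ ((5 : ℝ) * ((-1 : ℤ) : ℝ) / 2) * d i₁ 0 * (S i₀ (-1) t - S i₀ (-1 + 1) t) *
        S i₁ (-1) t + f₂ t) (Icc s T) t := fun t ht =>
    (hu t ⟨hs.trans ht.1, ht.2⟩).mono (Icc_subset_Icc_left hs)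
  have hf₂' : ∀ t ∈ Icc s T, |f₂ t| ≤ φ₂ := fun t ht => by
    rw [hφ₂]; exact hf₂ t ⟨hs.trans ht.1, ht.2⟩
  exact heteroclinicTriggerChain_forcedArcOn_trigger_decay (D := fun t => S i₀ (-1) t - S i₀ (-1 + 1) t)
    he' hL hu' hf₂' hdom

end Summit.NavierStokesRegularity.NavierStokesRegularity.Theorems

end
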